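import Mathlib.Analysis.SpecialFunctions.Gaussian.FourierTransform
import Mathlib.Analysis.SpecialFunctions.ImproperIntegrals
import Mathlib.Analysis.SpecialFunctions.Integrals.Basic
import Mathlib.MeasureTheory.Integral.Prod
import Mathlib.MeasureTheory.Group.Integral
import Mathlib.LinearAlgebra.Complex.FiniteDimensional
import HarnessLib

/-!
# Frullani's integral and positive-definiteness of planar Gaussian kernels

Two classical tools, proved here from Mathlib, for the Dirichlet energy `∬ G_{ℝ²} dφ dφ`,
`G_{ℝ²}(x,y) = -(1/2π) log|x - y|`, of the generalised test functions of
Duminil-Copin–Kozlowski–Lammers–Manolescu, arXiv:2603.06268 (2026), Def. 5–6 and Cor. 10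
(`Literature.Probability.Percolation.FKLoopNestingGaussianLimit`); they are combined in
`FKLoopNestingEnergyNonneg` into the positivity `∬ G_{ℝ²} dφ dφ ≥ 0` for neutral `φ`, which is what
makes `exp(-½σ²∬G dφ dφ)` a Gaussian characteristic function in Cor. 10.

* **Frullani's integral** for exponentials, `∫₀^∞ (e^{-at} - e^{-bt}) dt/t = log(b/a)`
  (`frullani_exp_of_le`), whence `-2 log r = ∫₀^∞ (e^{-tr²} - e^{-t}) dt/t` (`frullani_log`), with
  integrability of the integrands. Proof: `(e^{-at} - e^{-bt})/t = ∫ₐᵇ e^{-st} ds` and Fubini on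
  `[a,b] × (0,∞)` (the integrand is positive, the iterated integral is `∫ₐᵇ ds/s < ∞`).
* **Gaussian kernels on `ℂ = ℝ²` are positive definite on differences of finite measures**
  (`gaussian_form_sub_nonneg`): `∬ e^{-t|x-y|²} d(α-β)⊗d(α-β) ≥ 0`, written out as the signed
  combination of the four product integrals. Proof: the semigroup ("feature") identity
  `e^{-t|x-y|²} = (4t/π) ∫ e^{-2t|x-z|²} e^{-2t|y-z|²} dz` (`integral_exp_mul_exp`, from the planar
  Gaussian integral `∫ e^{-b|z|²} dz = π/b` and the parallelogram law) turns the form into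
  `(4t/π) ∫ (F_α - F_β)² dz ≥ 0`, `F_α(z) = ∫ e^{-2t|x-z|²} dα(x)` (`integral_prod_exp_neg_mul_sq_norm_sub`).

Everything is stated for finite measures on `ℂ` and Lebesgue measure (`volume`). Nothing here is
specific to percolation; the file lives next to its only user.

## References

* E. B. Saff, V. Totik, *Logarithmic Potentials with External Fields*, Springer (1997), Ch. I §1
  (Lemma 1.8: positivity of the logarithmic energy of a neutral signed measure) — the statement
  these tools serve; the heat-kernel route taken here is folklore.
* H. Duminil-Copin, K. K. Kozlowski, P. Lammers, I. Manolescu, arXiv:2603.06268 (2026), Def. 6,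
  Cor. 10.
-/

noncomputable section

open MeasureTheory Set Filter
open scoped Real Topology ENNReal NNReal

namespace Literature.Probability.Percolation

/-! ### Frullani's integral `∫₀^∞ (e^{-at} - e^{-bt}) dt/t = log(b/a)` -/

/-- `∫₀^∞ e^{-ts} dt = 1/s` for `s > 0`. [folklore] -/
theorem integral_exp_neg_mul_Ioi {s : ℝ} (hs : 0 < s) :
    ∫ t in Ioi (0 : ℝ), Real.exp (-(t * s)) = 1 / s := by
  have h := integral_exp_mul_Ioi (a := -s) (by linarith) 0
  simp only [mul_zero, Real.exp_zero, neg_mul] at h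
  simp_rw [mul_comm _ s]
  rw [h, neg_div_neg_eq]

/-- `t ↦ e^{-ts}` is integrable on `(0, ∞)` for `s > 0`. [folklore] -/
theorem integrableOn_exp_neg_mul_Ioi {s : ℝ} (hs : 0 < s) :
    IntegrableOn (fun t : ℝ ↦ Real.exp (-(t * s))) (Ioi 0) := by
  simpa only [neg_mul, mul_comm s] using exp_neg_integrableOn_Ioi 0 hs

/-- `∫ₐᵇ e^{-ts} ds = (e^{-ta} - e^{-tb}) / t` for `t ≠ 0`. [folklore] -/
theorem intervalIntegral_exp_neg_mul (a b : ℝ) {t : ℝ} (ht : t ≠ 0) :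
    ∫ s in a..b, Real.exp (-(t * s)) = (Real.exp (-(t * a)) - Real.exp (-(t * b))) / t := by
  have h := intervalIntegral.integral_comp_mul_left Real.exp (neg_ne_zero.2 ht) (a := a) (b := b)
  simp only [neg_mul] at h
  rw [h, integral_exp, smul_eq_mul]
  field_simp
  ring

/-- Frullani for exponentials, `0 < a ≤ b`: integrability on `(0, ∞)` and the value. [folklore] -/
theorem frullani_exp_of_le {a b : ℝ} (ha : 0 < a) (hab : a ≤ b) :
    IntegrableOn (fun t : ℝ ↦ (Real.exp (-(t * a)) - Real.exp (-(t * b))) / t) (Ioi 0) ∧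
      ∫ t in Ioi (0 : ℝ), (Real.exp (-(t * a)) - Real.exp (-(t * b))) / t =
        Real.log b - Real.log a := by
  have hb : 0 < b := lt_of_lt_of_le ha hab
  set μ : Measure ℝ := volume.restrict (Ioi (0 : ℝ)) with hμ
  have huIoc : uIoc a b = Ioc a b := uIoc_of_le hab
  -- joint integrability of `(s, t) ↦ e^{-ts}` on `[a, b] × (0, ∞)`
  have hF : Integrable (Function.uncurry fun s t : ℝ ↦ Real.exp (-(t * s)))
      ((volume.restrict (uIoc a b)).prod μ) := by
    have hmeas : AEStronglyMeasurable (Function.uncurry fun s t : ℝ ↦ Real.exp (-(t * s)))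
        ((volume.restrict (uIoc a b)).prod μ) :=
      (by fun_prop : Continuous fun p : ℝ × ℝ ↦ Real.exp (-(p.2 * p.1))).aestronglyMeasurable
    rw [integrable_prod_iff hmeas]
    constructor
    · rw [ae_restrict_iff' measurableSet_uIoc, huIoc]
      refine ae_of_all _ fun s hs ↦ ?_
      exact integrableOn_exp_neg_mul_Ioi (lt_trans ha hs.1)
    · have h1 : IntegrableOn (fun s : ℝ ↦ 1 / s) (uIoc a b) volume := by
        rw [huIoc]
        refine (ContinuousOn.integrableOn_Icc ?_).mono_set Ioc_subset_Icc_self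
        exact continuousOn_const.div continuousOn_id fun s hs ↦ (lt_of_lt_of_le ha hs.1).ne'
      refine h1.congr_fun (fun s hs ↦ ?_) measurableSet_uIoc
      rw [huIoc] at hs
      have hs0 : 0 < s := lt_trans ha hs.1
      simp only [Function.uncurry_apply_pair, Real.norm_eq_abs, Real.abs_exp]
      exact (integral_exp_neg_mul_Ioi hs0).symm
  -- the value of the inner `t`-integral
  have hinner : ∀ s ∈ uIcc a b, ∫ t, Real.exp (-(t * s)) ∂μ = 1 / s := by
    intro s hs
    rw [uIcc_of_le hab] at hs
    exact integral_exp_neg_mul_Ioi (lt_of_lt_of_le ha hs.1)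
  -- the `t`-integrand is the inner `s`-integral
  have hswap : ∫ s in a..b, ∫ t, Real.exp (-(t * s)) ∂μ = ∫ t, (∫ s in a..b, Real.exp (-(t * s))) ∂μ :=
    intervalIntegral_integral_swap hF
  have hval : ∫ t, (∫ s in a..b, Real.exp (-(t * s))) ∂μ = Real.log b - Real.log a := by
    rw [← hswap, intervalIntegral.integral_congr hinner, integral_one_div_of_pos ha hb,
      Real.log_div hb.ne' ha.ne']
  have hcongr : EqOn (fun t : ℝ ↦ ∫ s in a..b, Real.exp (-(t * s)))
      (fun t : ℝ ↦ (Real.exp (-(t * a)) - Real.exp (-(t * b))) / t) (Ioi 0) :=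
    fun t ht ↦ intervalIntegral_exp_neg_mul a b (ne_of_gt ht)
  refine ⟨?_, ?_⟩
  · have hI : Integrable (fun t : ℝ ↦ ∫ s in a..b, Real.exp (-(t * s))) μ := by
      have := hF.integral_prod_right
      refine this.congr (ae_of_all _ fun t ↦ ?_)
      simp only [Function.uncurry_apply_pair]
      rw [intervalIntegral.integral_of_le hab, huIoc]
    exact IntegrableOn.congr_fun hI hcongr measurableSet_Ioi
  · rw [← hval]
    exact (setIntegral_congr_fun measurableSet_Ioi hcongr).symm

/-- Frullani for the logarithm: `-2 log r = ∫₀^∞ (e^{-t r²} - e^{-t}) dt / t` for `r > 0`, with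
integrability of the integrand. [folklore] -/
theorem frullani_log {r : ℝ} (hr : 0 < r) :
    IntegrableOn (fun t : ℝ ↦ (Real.exp (-(t * r ^ 2)) - Real.exp (-(t * 1))) / t) (Ioi 0) ∧
      ∫ t in Ioi (0 : ℝ), (Real.exp (-(t * r ^ 2)) - Real.exp (-(t * 1))) / t =
        -2 * Real.log r := by
  have hr2 : 0 < r ^ 2 := by positivity
  rcases le_total (r ^ 2) 1 with h | h
  · obtain ⟨hi, hv⟩ := frullani_exp_of_le hr2 h
    refine ⟨hi, ?_⟩
    rw [hv, Real.log_one, Real.log_pow]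
    push_cast
    ring
  · obtain ⟨hi, hv⟩ := frullani_exp_of_le one_pos h
    have hneg : (fun t : ℝ ↦ (Real.exp (-(t * r ^ 2)) - Real.exp (-(t * 1))) / t) =
        fun t ↦ -((Real.exp (-(t * 1)) - Real.exp (-(t * r ^ 2))) / t) := by
      funext t; ring
    rw [hneg]
    refine ⟨hi.neg, ?_⟩
    rw [integral_neg, hv, Real.log_one, Real.log_pow]
    push_cast
    ring

/-! ### Gaussian kernels on the plane are positive definite -/

/-- The planar Gaussian integral `∫_ℂ e^{-b|z|²} dz = π / b` (Mathlib's
`GaussianFourier.integral_rexp_neg_mul_sq_norm` in real dimension `2`). [folklore] -/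
theorem integral_exp_neg_mul_sq_norm_complex {b : ℝ} (hb : 0 < b) :
    ∫ z : ℂ, Real.exp (-b * ‖z‖ ^ 2) = π / b := by
  have h := GaussianFourier.integral_rexp_neg_mul_sq_norm hb (V := ℂ)
  rw [Complex.finrank_real_complex] at h
  rw [h]
  norm_num

/-- The translated planar Gaussian integral `∫_ℂ e^{-b|z-m|²} dz = π / b`. [folklore] -/
theorem integral_exp_neg_mul_sq_norm_sub_complex {b : ℝ} (hb : 0 < b) (m : ℂ) :
    ∫ z : ℂ, Real.exp (-b * ‖z - m‖ ^ 2) = π / b := by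
  rw [integral_sub_right_eq_self (fun z : ℂ ↦ Real.exp (-b * ‖z‖ ^ 2)) m]
  exact integral_exp_neg_mul_sq_norm_complex hb

/-- `z ↦ e^{-b|z-m|²}` is Lebesgue integrable on `ℂ` for `b > 0`. [folklore] -/
theorem integrable_exp_neg_mul_sq_norm_sub_complex {b : ℝ} (hb : 0 < b) (m : ℂ) :
    Integrable (fun z : ℂ ↦ Real.exp (-b * ‖z - m‖ ^ 2)) := by
  by_contra h
  have h1 := integral_exp_neg_mul_sq_norm_sub_complex hb m
  rw [integral_undef h] at h1
  have : 0 < π / b := div_pos Real.pi_pos hb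
  linarith

/-- The parallelogram identity behind the Gaussian semigroup. [folklore] -/
theorem two_mul_sq_norm_sub_add (x y z : ℂ) :
    2 * ‖x - z‖ ^ 2 + 2 * ‖y - z‖ ^ 2 = ‖x - y‖ ^ 2 + 4 * ‖z - (x + y) / 2‖ ^ 2 := by
  simp only [Complex.sq_norm, Complex.normSq_apply, Complex.sub_re, Complex.sub_im, Complex.add_re,
    Complex.add_im, Complex.div_ofNat_re, Complex.div_ofNat_im]
  ring

/-- `e^{-2t|x-z|²} e^{-2t|y-z|²} = e^{-t|x-y|²} e^{-4t|z-(x+y)/2|²}`. [folklore] -/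
theorem exp_mul_exp_eq (t : ℝ) (x y z : ℂ) :
    Real.exp (-(2 * t) * ‖x - z‖ ^ 2) * Real.exp (-(2 * t) * ‖y - z‖ ^ 2) =
      Real.exp (-t * ‖x - y‖ ^ 2) * Real.exp (-(4 * t) * ‖z - (x + y) / 2‖ ^ 2) := by
  rw [← Real.exp_add, ← Real.exp_add]
  congr 1
  have := two_mul_sq_norm_sub_add x y z
  linear_combination (-t) * this

/-- Gaussian semigroup identity: `e^{-t|x-y|²} = (4t/π) ∫ e^{-2t|x-z|²} e^{-2t|y-z|²} dz`. [folklore] -/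
theorem integral_exp_mul_exp (t : ℝ) (ht : 0 < t) (x y : ℂ) :
    ∫ z : ℂ, Real.exp (-(2 * t) * ‖x - z‖ ^ 2) * Real.exp (-(2 * t) * ‖y - z‖ ^ 2) =
      π / (4 * t) * Real.exp (-t * ‖x - y‖ ^ 2) := by
  simp_rw [exp_mul_exp_eq t x y]
  rw [integral_const_mul, integral_exp_neg_mul_sq_norm_sub_complex (by positivity)]
  ring


/-- Integrability of the Gaussian feature kernel `(z, x) ↦ e^{-2t|x-z|²}` on `Leb ⊗ α` for a finite
measure `α`. [folklore] -/
theorem integrable_gaussKernel_prod (α : Measure ℂ) [IsFiniteMeasure α] {t : ℝ} (ht : 0 < t) :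
    Integrable (Function.uncurry fun (z x : ℂ) ↦ Real.exp (-(2 * t) * ‖x - z‖ ^ 2))
      ((volume : Measure ℂ).prod α) := by
  have hmeas : AEStronglyMeasurable (Function.uncurry fun (z x : ℂ) ↦ Real.exp (-(2 * t) * ‖x - z‖ ^ 2))
      ((volume : Measure ℂ).prod α) :=
    (by fun_prop : Continuous fun q : ℂ × ℂ ↦ Real.exp (-(2 * t) * ‖q.2 - q.1‖ ^ 2)).aestronglyMeasurable
  rw [integrable_prod_iff' hmeas]
  constructor
  · refine ae_of_all _ fun x ↦ ?_
    have := integrable_exp_neg_mul_sq_norm_sub_complex (b := 2 * t) (by positivity) x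
    refine this.congr (ae_of_all _ fun z ↦ ?_)
    simp only [Function.uncurry_apply_pair, norm_sub_rev x z]
  · have heq : (fun x : ℂ ↦ ∫ z, ‖Function.uncurry (fun (z x : ℂ) ↦ Real.exp (-(2 * t) * ‖x - z‖ ^ 2)) (z, x)‖)
        = fun _ ↦ π / (2 * t) := by
      funext x
      simp only [Function.uncurry_apply_pair, Real.norm_eq_abs, Real.abs_exp]
      simp_rw [norm_sub_rev x]
      exact integral_exp_neg_mul_sq_norm_sub_complex (by positivity) x
    rw [heq]
    exact integrable_const _

/-- The Gaussian feature `z ↦ ∫ e^{-2t|x-z|²} dα(x)` of a finite measure is Lebesgue integrable.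
[folklore] -/
theorem integrable_gaussFeature (α : Measure ℂ) [IsFiniteMeasure α] {t : ℝ} (ht : 0 < t) :
    Integrable (fun z : ℂ ↦ ∫ x, Real.exp (-(2 * t) * ‖x - z‖ ^ 2) ∂α) :=
  (integrable_gaussKernel_prod α ht).integral_prod_left

/-- The Gaussian feature is bounded by the total mass. [folklore] -/
theorem norm_gaussFeature_le (α : Measure ℂ) [IsFiniteMeasure α] (t : ℝ) (ht : 0 ≤ t) (z : ℂ) :
    ‖∫ x, Real.exp (-(2 * t) * ‖x - z‖ ^ 2) ∂α‖ ≤ 1 * α.real univ := by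
  refine norm_integral_le_of_norm_le_const (ae_of_all _ fun x ↦ ?_)
  rw [Real.norm_of_nonneg (Real.exp_pos _).le, Real.exp_le_one_iff]
  nlinarith [sq_nonneg ‖x - z‖]

/-- The bounded Gaussian kernel is integrable for a product of finite measures. [folklore] -/
theorem integrable_exp_neg_mul_sq_norm_prod (α β : Measure ℂ) [IsFiniteMeasure α] [IsFiniteMeasure β]
    {t : ℝ} (ht : 0 ≤ t) :
    Integrable (fun p : ℂ × ℂ ↦ Real.exp (-t * ‖p.1 - p.2‖ ^ 2)) (α.prod β) := by
  refine (integrable_const (1 : ℝ)).mono' ?_ (ae_of_all _ fun p ↦ ?_)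
  · exact (by fun_prop : Continuous fun p : ℂ × ℂ ↦ Real.exp (-t * ‖p.1 - p.2‖ ^ 2)).aestronglyMeasurable
  · rw [Real.norm_of_nonneg (Real.exp_pos _).le, Real.exp_le_one_iff]
    nlinarith [sq_nonneg ‖p.1 - p.2‖]

/-- **Feature representation of the Gaussian bilinear form**: for finite measures `α, β` on the
plane and `t > 0`,
`∬ e^{-t|x-y|²} dα(x) dβ(y) = (4t/π) ∫ (∫ e^{-2t|x-z|²} dα(x)) (∫ e^{-2t|y-z|²} dβ(y)) dz`. [folklore] -/
theorem integral_prod_exp_neg_mul_sq_norm_sub (α β : Measure ℂ) [IsFiniteMeasure α] [IsFiniteMeasure β]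
    {t : ℝ} (ht : 0 < t) :
    ∫ p, Real.exp (-t * ‖p.1 - p.2‖ ^ 2) ∂(α.prod β) =
      4 * t / π * ∫ z, (∫ x, Real.exp (-(2 * t) * ‖x - z‖ ^ 2) ∂α) *
        (∫ y, Real.exp (-(2 * t) * ‖y - z‖ ^ 2) ∂β) := by
  have h1 : ∀ z : ℂ, (∫ x, Real.exp (-(2 * t) * ‖x - z‖ ^ 2) ∂α) *
      (∫ y, Real.exp (-(2 * t) * ‖y - z‖ ^ 2) ∂β) =
      ∫ p, Real.exp (-(2 * t) * ‖p.1 - z‖ ^ 2) * Real.exp (-(2 * t) * ‖p.2 - z‖ ^ 2) ∂(α.prod β) :=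
    fun z ↦ (integral_prod_mul (μ := α) (ν := β) (fun x : ℂ ↦ Real.exp (-(2 * t) * ‖x - z‖ ^ 2))
      (fun y : ℂ ↦ Real.exp (-(2 * t) * ‖y - z‖ ^ 2))).symm
  simp_rw [h1]
  have hG : Integrable (Function.uncurry fun (z : ℂ) (p : ℂ × ℂ) ↦
      Real.exp (-(2 * t) * ‖p.1 - z‖ ^ 2) * Real.exp (-(2 * t) * ‖p.2 - z‖ ^ 2))
      ((volume : Measure ℂ).prod (α.prod β)) := by
    have hmeas : AEStronglyMeasurable (Function.uncurry fun (z : ℂ) (p : ℂ × ℂ) ↦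
        Real.exp (-(2 * t) * ‖p.1 - z‖ ^ 2) * Real.exp (-(2 * t) * ‖p.2 - z‖ ^ 2))
        ((volume : Measure ℂ).prod (α.prod β)) :=
      (by fun_prop : Continuous fun q : ℂ × (ℂ × ℂ) ↦
        Real.exp (-(2 * t) * ‖q.2.1 - q.1‖ ^ 2) * Real.exp (-(2 * t) * ‖q.2.2 - q.1‖ ^ 2)).aestronglyMeasurable
    rw [integrable_prod_iff' hmeas]
    constructor
    · refine ae_of_all _ fun p ↦ ?_
      simp only [Function.uncurry_apply_pair]
      simp_rw [exp_mul_exp_eq t p.1 p.2]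
      exact (integrable_exp_neg_mul_sq_norm_sub_complex (by positivity) _).const_mul _
    · have heq : (fun p : ℂ × ℂ ↦ ∫ z, ‖Function.uncurry (fun (z : ℂ) (p : ℂ × ℂ) ↦
          Real.exp (-(2 * t) * ‖p.1 - z‖ ^ 2) * Real.exp (-(2 * t) * ‖p.2 - z‖ ^ 2)) (z, p)‖) =
          fun p ↦ π / (4 * t) * Real.exp (-t * ‖p.1 - p.2‖ ^ 2) := by
        funext p
        simp only [Function.uncurry_apply_pair]
        rw [← integral_exp_mul_exp t ht p.1 p.2]
        refine integral_congr_ae (ae_of_all _ fun z ↦ ?_)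
        exact Real.norm_of_nonneg (by positivity)
      rw [heq]
      exact (integrable_exp_neg_mul_sq_norm_prod α β ht.le).const_mul _
  rw [integral_integral_swap hG]
  have h2 : ∀ p : ℂ × ℂ, ∫ z, Real.exp (-(2 * t) * ‖p.1 - z‖ ^ 2) * Real.exp (-(2 * t) * ‖p.2 - z‖ ^ 2) =
      π / (4 * t) * Real.exp (-t * ‖p.1 - p.2‖ ^ 2) := fun p ↦ integral_exp_mul_exp t ht p.1 p.2
  simp_rw [h2]
  rw [integral_const_mul, ← mul_assoc]
  rw [show 4 * t / π * (π / (4 * t)) = 1 by field_simp]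
  rw [one_mul]

/-- **Gaussian kernels are positive definite on differences of finite measures**: for finite
measures `α, β` on the plane and `t > 0`, with `K_t(x,y) = e^{-t|x-y|²}`,
`∬ K_t d(α⊗α) - ∬ K_t d(α⊗β) - ∬ K_t d(β⊗α) + ∬ K_t d(β⊗β) ≥ 0`
(it equals `(4t/π) ∫ (F_α - F_β)²` for the Gaussian features). [folklore] -/
theorem gaussian_form_sub_nonneg (α β : Measure ℂ) [IsFiniteMeasure α] [IsFiniteMeasure β]
    {t : ℝ} (ht : 0 < t) :
    0 ≤ (∫ p, Real.exp (-t * ‖p.1 - p.2‖ ^ 2) ∂(α.prod α)) -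
        (∫ p, Real.exp (-t * ‖p.1 - p.2‖ ^ 2) ∂(α.prod β)) -
        (∫ p, Real.exp (-t * ‖p.1 - p.2‖ ^ 2) ∂(β.prod α)) +
        ∫ p, Real.exp (-t * ‖p.1 - p.2‖ ^ 2) ∂(β.prod β) := by
  set A : ℂ → ℝ := fun z ↦ ∫ x, Real.exp (-(2 * t) * ‖x - z‖ ^ 2) ∂α with hA
  set B : ℂ → ℝ := fun z ↦ ∫ y, Real.exp (-(2 * t) * ‖y - z‖ ^ 2) ∂β with hB
  have hAi : Integrable A := integrable_gaussFeature α ht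
  have hBi : Integrable B := integrable_gaussFeature β ht
  have hAb : ∀ᵐ z ∂(volume : Measure ℂ), ‖A z‖ ≤ 1 * α.real univ :=
    ae_of_all _ fun z ↦ norm_gaussFeature_le α t ht.le z
  have hBb : ∀ᵐ z ∂(volume : Measure ℂ), ‖B z‖ ≤ 1 * β.real univ :=
    ae_of_all _ fun z ↦ norm_gaussFeature_le β t ht.le z
  have hAA : Integrable fun z ↦ A z * A z := hAi.bdd_mul hAi.aestronglyMeasurable hAb
  have hAB : Integrable fun z ↦ A z * B z := hBi.bdd_mul hAi.aestronglyMeasurable hAb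
  have hBA : Integrable fun z ↦ B z * A z := hAi.bdd_mul hBi.aestronglyMeasurable hBb
  have hBB : Integrable fun z ↦ B z * B z := hBi.bdd_mul hBi.aestronglyMeasurable hBb
  rw [integral_prod_exp_neg_mul_sq_norm_sub α α ht, integral_prod_exp_neg_mul_sq_norm_sub α β ht,
    integral_prod_exp_neg_mul_sq_norm_sub β α ht, integral_prod_exp_neg_mul_sq_norm_sub β β ht]
  have h2 : Integrable fun z ↦ A z * A z - A z * B z := hAA.sub hAB
  have h3 : Integrable fun z ↦ A z * A z - A z * B z - B z * A z := h2.sub hBA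
  have hsq : ∫ z, (A z - B z) ^ 2 =
      (∫ z, A z * A z) - (∫ z, A z * B z) - (∫ z, B z * A z) + ∫ z, B z * B z := by
    have e : (fun z ↦ (A z - B z) ^ 2) = fun z ↦ A z * A z - A z * B z - B z * A z + B z * B z := by
      funext z; ring
    rw [e, integral_add h3 hBB, integral_sub h2 hBA, integral_sub hAA hAB]
  have hc : 0 < 4 * t / π := by positivity
  have key : 4 * t / π * (∫ z, A z * A z) - 4 * t / π * (∫ z, A z * B z) -
      4 * t / π * (∫ z, B z * A z) + 4 * t / π * (∫ z, B z * B z) = 4 * t / π * ∫ z, (A z - B z) ^ 2 := by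
    rw [hsq]; ring
  rw [key]
  exact mul_nonneg hc.le (integral_nonneg fun z ↦ sq_nonneg _)


/-- The same positivity with the kernel written `e^{-(t|x-y|²)}`. [folklore] -/
theorem gaussian_form_sub_nonneg' (α β : Measure ℂ) [IsFiniteMeasure α] [IsFiniteMeasure β]
    {t : ℝ} (ht : 0 < t) :
    0 ≤ (∫ p, Real.exp (-(t * ‖p.1 - p.2‖ ^ 2)) ∂(α.prod α)) -
        (∫ p, Real.exp (-(t * ‖p.1 - p.2‖ ^ 2)) ∂(α.prod β)) -
        (∫ p, Real.exp (-(t * ‖p.1 - p.2‖ ^ 2)) ∂(β.prod α)) +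
        ∫ p, Real.exp (-(t * ‖p.1 - p.2‖ ^ 2)) ∂(β.prod β) := by
  simpa only [neg_mul] using gaussian_form_sub_nonneg α β ht

end Literature.Probability.Percolation

end
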